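import Literature.IUT.HodgeArakelov.GaloisPairCyclotomesGenuineRigidity

/-!
# NV-L6/GalRigidityInput at the genuine `AbsTopMonoids`: the residual naturality (b) SPLIT into its two
# print-shaped halves — (b1) naturality of the LCFT identification `μ_Ẑ(G_k) ⥲ Λ(k̄ˣ)` under a units transport
# `β_φ : k̄ˣ ⥲ k̄ˣ` along `φ`, (b2) `β_φ` restricts on `𝒪_k̄^⊳` to THE lift `liftM φ`

Mochizuki, *Inter-universal Teichmüller theory II*, §1, Cor. 1.11 (a), kurims manuscript (Dec. 2020) p. 49
ll. 9–21 [claim: Mochizuki2012, status: disputed] (IUTchII §1 Cor 1.11, kurims p.49); Mochizuki, *Topics in absolute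
anabelian geometry III*, Rmk. 3.2.1 p. 73, Cor. 1.10 (i) p. 42 [cite: MochizukiAbsTopIII2015, Remark 3.2.1 p.73];
Mochizuki, *The absolute anabelian geometry of hyperbolic curves* (2004), Prop. 1.2.1 (vi)(vii) pp. 10–11
[cite: MochizukiAbsAnab2004, Prop 1.2.1 (vii) p.11].

abc-iut cell, layer L6; seat abc-iut-w4-d030 (gen 2), sequel of `GaloisPairCyclotomesGenuineRigidity` (p421900):
there `nonempty_galRigidityInput_genuineOfModel` reduced abc-iut-w4-d024's `GalRigidityInput` over abc-iut-L6-t13's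
genuine producer `AbsTopMonoids.genuineOfModel` to ONE hypothesis `hnat` (b) phrased with the COMPOSITE Rmk. 3.2.1
isomorphism `Λ((𝒪_k̄^⊳)ˣ) ⥲ Λ(k̄ˣ) ⥲ μ_Ẑ(G_k)`. The cell's L4 hands prove (b) in two print-shaped pieces
(abc-iut-L6-t11 g6 «RMK321-NAT»: the LCFT identification `μ_Ẑ(G_k) ⥲ Λ(k̄ˣ)` is natural for every topological
automorphism `φ` of `G_k` and every `α`-equivariant units transport `β_φ : k̄ˣ ⥲ k̄ˣ` of [AbsAnab] Prop. 1.2.1 (vii);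
abc-iut-L6-t13 g4 «RESTRICT-𝒪⊳»: such a `β_φ` restricts to `𝒪_k̄^⊳` and the restriction is THE lift
`Genuine.liftM φ` of [AbsTopIII] Prop. 3.2 (iv)). THIS FILE (proof-only) is the bookkeeping that turns the two
halves into `hnat`: naturality of abc-iut-L4-t2's tautological `Λ((𝒪_k̄^⊳)ˣ) ⥲ Λ(k̄ˣ)` (`MLFClosure.cyclotomeUnitsEquiv`)
in every pair `(ψ, β)` with `β|_{𝒪^⊳} = ψ` (`cyclotomeUnitsHom_map_of_restrict`,
`cyclotomeUnitsEquiv_symm_map_of_restrict`), the lift of (b1) from the `μ_{ℚ/ℤ}` level (`D.muLift`, the shape of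
[AbsAnab] Prop. 1.2.1 (vi)) to the `Λ` level (`muZhatEquiv_congr_of_muLift`), then `hnat_of_unitsTransport` and the assembled
`nonempty_galRigidityInput_genuineOfModel_of_unitsTransport (β) (hβ : β_φ|_{𝒪^⊳} = liftM φ) (hN : (b1))`.
HONEST LIMITS: bookkeeping over hypotheses (b1), (b2) stated inline (no `def … : Prop`); nothing of [IUTchII] is
asserted; no side is taken on [IUTchIII] Cor. 3.12. Proof-only, no definitions.
-/

noncomputable section

namespace Literature.IUT.HodgeArakelov

open CategoryTheory Literature.AnabelianGeometry.AbsoluteAnabelian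
open Literature.AnabelianGeometry.EtaleTheta (cyclotome)

namespace AbsTopMonoids.Genuine

universe u

section Restrict

variable (C : MLFClosure.{u})

/-- **Naturality of `Λ((𝒪_k̄^⊳)ˣ) → Λ(k̄ˣ)`**: for a monoid endomorphism `ψ` of `𝒪_k̄^⊳` and a homomorphism
`β` of `k̄ˣ` agreeing with `ψ` on the units of `𝒪_k̄^⊳`, `Λ(β) ∘ Λ(ι) = Λ(ι) ∘ Λ(ψ)` (componentwise).
[cite: MochizukiAbsTopIII2015, Remark 3.2.1 p.73] -/
theorem cyclotomeUnitsHom_map_of_restrict (ψ : nonzeroIntegers C.k C.K →* nonzeroIntegers C.k C.K)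
    (β : (C.K)ˣ →* (C.K)ˣ)
    (hβ : ∀ u : (nonzeroIntegers C.k C.K)ˣ,
      (β (Units.map ((nonzeroIntegers C.k C.K).subtype : nonzeroIntegers C.k C.K →* C.K) u) : C.K) =
        ((ψ (u : nonzeroIntegers C.k C.K) : nonzeroIntegers C.k C.K) : C.K))
    (ζ : cyclotome (nonzeroIntegers C.k C.K)) :
    C.cyclotomeUnitsHom (cyclotome.map (Units.map ψ) ζ) =
      Literature.AnabelianGeometry.EtaleTheta.cyclotome.map β (C.cyclotomeUnitsHom ζ) := by
  refine Subtype.ext (funext fun n => Units.ext ?_)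
  rw [MLFClosure.coe_cyclotomeUnitsHom_apply, cyclotome.map_apply, Units.coe_map,
    Literature.AnabelianGeometry.EtaleTheta.cyclotome.map_apply]
  exact (hβ ((ζ : ℕ+ → (nonzeroIntegers C.k C.K)ˣ) n)).symm

/-- **Naturality of the Rmk. 3.2.1 model isomorphism `Λ((𝒪_k̄^⊳)ˣ) ⥲ Λ(k̄ˣ)`, inverse form**: with `ψ`, `β` as in
`cyclotomeUnitsHom_map_of_restrict`, `(Λ(ι))⁻¹ ∘ Λ(β) = Λ(ψ) ∘ (Λ(ι))⁻¹`.
[cite: MochizukiAbsTopIII2015, Remark 3.2.1 p.73] -/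
theorem cyclotomeUnitsEquiv_symm_map_of_restrict (ψ : nonzeroIntegers C.k C.K →* nonzeroIntegers C.k C.K)
    (β : (C.K)ˣ →* (C.K)ˣ)
    (hβ : ∀ u : (nonzeroIntegers C.k C.K)ˣ,
      (β (Units.map ((nonzeroIntegers C.k C.K).subtype : nonzeroIntegers C.k C.K →* C.K) u) : C.K) =
        ((ψ (u : nonzeroIntegers C.k C.K) : nonzeroIntegers C.k C.K) : C.K))
    (ξ : Literature.AnabelianGeometry.EtaleTheta.cyclotome (C.K)ˣ) :
    C.cyclotomeUnitsEquiv.symm (Literature.AnabelianGeometry.EtaleTheta.cyclotome.map β ξ) =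
      cyclotome.map (Units.map ψ) (C.cyclotomeUnitsEquiv.symm ξ) := by
  apply C.cyclotomeUnitsEquiv.injective
  rw [MulEquiv.apply_symm_apply]
  change _ = C.cyclotomeUnitsHom (cyclotome.map (Units.map ψ) (C.cyclotomeUnitsEquiv.symm ξ))
  rw [cyclotomeUnitsHom_map_of_restrict C ψ β hβ]
  change _ = Literature.AnabelianGeometry.EtaleTheta.cyclotome.map β
    (C.cyclotomeUnitsEquiv (C.cyclotomeUnitsEquiv.symm ξ))
  rw [MulEquiv.apply_symm_apply]

end Restrict

section Assemble

variable (k : Type) [Field k] [CharZero k] [ValuativeRel k] [TopologicalSpace k] [IsNonarchimedeanLocalField k]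

/-- **(b) from (b1) + (b2).** For reciprocity data `D`, a topological automorphism `φ` of `Gal(k̄/k)` and a
homomorphism `β : k̄ˣ → k̄ˣ` such that (b2) `β` agrees with THE lift `liftM φ` on the units of `𝒪_k̄^⊳` and (b1)
the LCFT identification `D.muZhatEquiv : μ_Ẑ(G_k) ⥲ Λ(k̄ˣ)` intertwines `μ_Ẑ(φ)` with `Λ(β)`, the composite
Rmk. 3.2.1 iso `Λ((𝒪_k̄^⊳)ˣ) ⥲ μ_Ẑ(G_k)` intertwines `μ_Ẑ(φ)` with `Λ(liftM φ)` — the hypothesis `hnat` of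
`nonempty_galRigidityInput_genuineOfModel` at `φ`. [cite: MochizukiAbsTopIII2015, Remark 3.2.1 p.73] -/
theorem hnat_of_unitsTransport (D : TorsionReciprocityData k)
    (φ : haveI := compactSpace_stdGalois k
      (ModelMLFGaloisData.galois (MLFClosure.std k).k (MLFClosure.std k).K).tmPair.Pi ≃ₜ*
        (ModelMLFGaloisData.galois (MLFClosure.std k).k (MLFClosure.std k).K).tmPair.Pi)
    (β : (AlgebraicClosure k)ˣ →* (AlgebraicClosure k)ˣ)
    (hβ : haveI := compactSpace_stdGalois k
      ∀ u : (nonzeroIntegers k (AlgebraicClosure k))ˣ,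
        (β (Units.map ((nonzeroIntegers k (AlgebraicClosure k)).subtype :
            nonzeroIntegers k (AlgebraicClosure k) →* AlgebraicClosure k) u) : AlgebraicClosure k) =
          (Subtype.val (liftM (MLFClosure.std k) φ (u : nonzeroIntegers k (AlgebraicClosure k))) :
            AlgebraicClosure k))
    (hN : haveI := compactSpace_stdGalois k
      ∀ y : muZhat (Field.absoluteGaloisGroup k),
        D.muZhatEquiv (muZhat.congr φ y) =
          Literature.AnabelianGeometry.EtaleTheta.cyclotome.map β (D.muZhatEquiv y))
    (y : muZhat (Field.absoluteGaloisGroup k)) :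
    haveI := compactSpace_stdGalois k
    D.cyclotomeNonzeroIntegersEquivMuZhat.symm (muZhat.congr φ y) =
      cyclotome.map (Units.map (liftM (MLFClosure.std k) φ).toMonoidHom)
        (D.cyclotomeNonzeroIntegersEquivMuZhat.symm y) := by
  haveI := compactSpace_stdGalois k
  change (MLFClosure.std k).cyclotomeUnitsEquiv.symm (D.muZhatEquiv (muZhat.congr φ y)) =
    cyclotome.map (Units.map (liftM (MLFClosure.std k) φ).toMonoidHom)
      ((MLFClosure.std k).cyclotomeUnitsEquiv.symm (D.muZhatEquiv y))
  rw [hN]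
  exact cyclotomeUnitsEquiv_symm_map_of_restrict (MLFClosure.std k) (liftM (MLFClosure.std k) φ).toMonoidHom β
    hβ _

/-- **(b1) at the `μ_{ℚ/ℤ}` level lifts to the `Λ` level.** If the torsion identification
`D.muLift : μ_{ℚ/ℤ}(G_k) → k̄ˣ` (direct limit of the `Art_{L_U}⁻¹|_tors`) intertwines `μ_{ℚ/ℤ}(φ)` with `β`
([AbsAnab] Prop. 1.2.1 (vi) «Galois-equivariant with respect to α» for the torsion part of `ψ̄`), then
`D.muZhatEquiv = Hom(ℚ/ℤ, −)` of it intertwines `μ_Ẑ(φ)` with `Λ(β)` (componentwise).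
[cite: MochizukiAbsAnab2004, Prop 1.2.1 (vii) p.11] -/
theorem muZhatEquiv_congr_of_muLift (D : TorsionReciprocityData k)
    (φ : haveI := compactSpace_stdGalois k
      (ModelMLFGaloisData.galois (MLFClosure.std k).k (MLFClosure.std k).K).tmPair.Pi ≃ₜ*
        (ModelMLFGaloisData.galois (MLFClosure.std k).k (MLFClosure.std k).K).tmPair.Pi)
    (β : (AlgebraicClosure k)ˣ →* (AlgebraicClosure k)ˣ)
    (hμ : haveI := compactSpace_stdGalois k
      ∀ x : muQZ (Field.absoluteGaloisGroup k),
        Additive.toMul (D.muLift (muQZ.map φ x)) = β (Additive.toMul (D.muLift x)))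
    (y : muZhat (Field.absoluteGaloisGroup k)) :
    haveI := compactSpace_stdGalois k
    D.muZhatEquiv (muZhat.congr φ y) =
      Literature.AnabelianGeometry.EtaleTheta.cyclotome.map β (D.muZhatEquiv y) := by
  haveI := compactSpace_stdGalois k
  refine Subtype.ext (funext fun n => ?_)
  rw [TorsionReciprocityData.muZhatEquiv_apply_coe, Literature.AnabelianGeometry.EtaleTheta.cyclotome.map_apply,
    TorsionReciprocityData.muZhatEquiv_apply_coe, muZhat.coe_congr, muZhat.map_apply_coe]
  exact hμ _

variable {S : ThetaSetting.{0}} [CompactSpace S.Gk]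
  (ε : S.Gk ≃ₜ* (ModelMLFGaloisData.galois (MLFClosure.std k).k (MLFClosure.std k).K).tmPair.Pi)
  (hΔ : ∀ f : S.PiX ≃ₜ* S.PiX, S.DeltaX.map f.toMulEquiv.toMonoidHom = S.DeltaX)
  (hq : Nonempty (TopGroup.quot S.PiX S.DeltaX ≃ₜ* S.Gk)) (D : TorsionReciprocityData k)

/-- **NV-L6/GalRigidityInput at the GENUINE `AbsTopMonoids`, modulo (b1) + (b2).** If every topological
automorphism `φ` of `Gal(k̄/k)` admits a units transport `β φ : k̄ˣ → k̄ˣ` ([AbsAnab] Prop. 1.2.1 (vii)) which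
(b2) restricts on `𝒪_k̄^⊳` to THE lift `liftM φ` and (b1) is intertwined with `μ_Ẑ(φ)` by the LCFT identification
`D.muZhatEquiv`, then abc-iut-w4-d024's `GalRigidityInput (AbsTopMonoids.genuineOfModel S (MLFClosure.std k) ε hΔ hq)`
is inhabited (by `nonempty_galRigidityInput_genuineOfModel`, `hnat := hnat_of_unitsTransport`).
[claim: Mochizuki2012, status: disputed] (IUTchII §1 Cor 1.11, kurims p.49) -/
theorem nonempty_galRigidityInput_genuineOfModel_of_unitsTransport
    (β : haveI := compactSpace_stdGalois k
      ((ModelMLFGaloisData.galois (MLFClosure.std k).k (MLFClosure.std k).K).tmPair.Pi ≃ₜ*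
        (ModelMLFGaloisData.galois (MLFClosure.std k).k (MLFClosure.std k).K).tmPair.Pi) →
        ((AlgebraicClosure k)ˣ →* (AlgebraicClosure k)ˣ))
    (hβ : haveI := compactSpace_stdGalois k
      ∀ (φ : (ModelMLFGaloisData.galois (MLFClosure.std k).k (MLFClosure.std k).K).tmPair.Pi ≃ₜ*
          (ModelMLFGaloisData.galois (MLFClosure.std k).k (MLFClosure.std k).K).tmPair.Pi)
        (u : (nonzeroIntegers k (AlgebraicClosure k))ˣ),
        (β φ (Units.map ((nonzeroIntegers k (AlgebraicClosure k)).subtype :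
            nonzeroIntegers k (AlgebraicClosure k) →* AlgebraicClosure k) u) : AlgebraicClosure k) =
          (Subtype.val (liftM (MLFClosure.std k) φ (u : nonzeroIntegers k (AlgebraicClosure k))) :
            AlgebraicClosure k))
    (hN : haveI := compactSpace_stdGalois k
      ∀ (φ : (ModelMLFGaloisData.galois (MLFClosure.std k).k (MLFClosure.std k).K).tmPair.Pi ≃ₜ*
          (ModelMLFGaloisData.galois (MLFClosure.std k).k (MLFClosure.std k).K).tmPair.Pi)
        (y : muZhat (Field.absoluteGaloisGroup k)),
        D.muZhatEquiv (muZhat.congr φ y) =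
          Literature.AnabelianGeometry.EtaleTheta.cyclotome.map (β φ) (D.muZhatEquiv y)) :
    Nonempty (GalRigidityInput (AbsTopMonoids.genuineOfModel S (MLFClosure.std k) ε hΔ hq)) :=
  nonempty_galRigidityInput_genuineOfModel k ε hΔ hq D fun φ y =>
    hnat_of_unitsTransport k D φ (β φ) (hβ φ) (hN φ) y

end Assemble

end AbsTopMonoids.Genuine

end Literature.IUT.HodgeArakelov

end
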